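import Literature.AlgebraicTopology.SingularHomology.LocallyFlatComplement
import Literature.AlgebraicTopology.SingularHomology.StratumLocalHomology
import Literature.AlgebraicTopology.SingularHomology.LocalHomologyVanishing
import Literature.AlgebraicTopology.SingularHomology.LocalHomologyIso
import Literature.AlgebraicTopology.SingularHomology.RelativeMayerVietorisPairs
import HarnessLib

/-!
# The Thom-degree local model: `H_k(B | L)` for a ball `B` of `F × K` at the flat piece
# `L = {0} × K`, `dim F = k`

A. Hatcher, *Algebraic Topology* (2002), §3.3 p. 231 (`H_k(ℝᵏ | 0) ≅ R`) with Prop. 2.19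
(products with a contractible factor) and Thm. 2.20 (excision); J. Milnor, J. Stasheff,
*Characteristic Classes* (1974), §10 (the local Thom class of a product neighbourhood). For real
normed spaces `F` (dimension `k`) and `K`, the sup-metric ball `B = B((0, y), r) = B_F(0, r) × B_K(y, r)`
and the flat piece `L = {p | p.1 = 0}`:

* `isIso_map_fstVal_ball` — **`p ↦ p.1 : (B, B ∖ L) → (F, F ∖ 0)` induces an isomorphism
  `H_n(B | L) ≅ H_n(F | 0)`** for every `n` (product with the contractible `B_K(y, r)`,
  `StratumLocalHomology.isIso_map_fst_prod`, then excision of the open ball `B_F(0, r) ∋ 0`);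
* `isIso_map_subsetInclusion_ball` — hence for concentric balls `B' = B((0, y'), r') ⊆ B` the map
  `H_n(B' | L) → H_n(B | L)` is an isomorphism (both compare to `H_n(F | 0)`);
* `localHomologyOfSet_ball_cyclic` — and `H_k(B | L; R)`, `k = dim F`, is generated by one class
  (`H_k(F | 0; R) ≅ R`, `localHomologyIsoOfChart'`).

These are the hypotheses "cyclic local groups, isomorphic nested maps" of the cyclicity engine
`localHomologyOfSet_cyclic_of_basis` (`LocalHomologyThomDegreeCyclic`) for the basis of straightened
balls of a locally flat closed subset. Everything is proved; no definitions, no named facts.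

## References

* [HatcherAT2002] A. Hatcher, Algebraic Topology, CUP 2002, §3.3 p. 231, Prop. 2.19, Thm. 2.20.
* [MilnorStasheff1974] J. Milnor, J. Stasheff, Characteristic Classes (1974), §10.
-/

noncomputable section

open CategoryTheory Limits Set Metric

namespace Literature.AlgebraicTopology.SingularHomology

/-! ### The ball at the flat piece -/

section Model

variable (R : Type) [CommRing R]
variable {F K : Type} [NormedAddCommGroup F] [NormedSpace ℝ F] [FiniteDimensional ℝ F]
  [NormedAddCommGroup K] [NormedSpace ℝ K]

omit [NormedSpace ℝ F] [FiniteDimensional ℝ F] [NormedSpace ℝ K] in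
/-- `p ↦ p.1` maps the ball minus the flat piece into `F ∖ 0` (a map of pairs
`(B, B ∖ L) → (F, F ∖ 0)`). [folklore] -/
theorem mapsTo_fstVal_ball (y : K) (r : ℝ) :
    MapsTo ((ContinuousMap.fst : C(F × K, F)).comp (subsetIncl (ball ((0 : F), y) r)))
      ((Subtype.val ⁻¹' {p : F × K | p.1 = 0})ᶜ : Set ↥(ball ((0 : F), y) r)) ({0}ᶜ : Set F) :=
  fun _ hp ↦ hp

omit [NormedSpace ℝ F] [FiniteDimensional ℝ F] in
/-- **`H_n(B | L) ≅ H_n(F | 0)` by `p ↦ p.1`**, for the ball `B = B((0, y), r)` of `F × K` and the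
flat piece `L = {p | p.1 = 0}` (`B = B_F(0, r) × B_K(y, r)` with `B_K` contractible, Hatcher
Prop. 2.19 in the form `StratumLocalHomology.isIso_map_fst_prod`; then excision of the open ball
`B_F(0, r) ∋ 0` in `F`, Thm. 2.20). [cite: HatcherAT2002, Prop. 2.19 and Thm. 2.20] -/
theorem isIso_map_fstVal_ball (y : K) {r : ℝ} (hr : 0 < r) (n : ℕ) :
    IsIso (relativeSingularHomology.map R R
      ((ContinuousMap.fst : C(F × K, F)).comp (subsetIncl (ball ((0 : F), y) r)))
      (mapsTo_fstVal_ball y r) n) := by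
  -- `B ≅ B_F × B_K`
  let e₁ : ↥(ball ((0 : F), y) r) ≃ₜ ↥(ball (0 : F) r ×ˢ ball y r) :=
    Homeomorph.setCongr (ball_prod_same (0 : F) y r).symm
  let h : ↥(ball ((0 : F), y) r) ≃ₜ ↥(ball (0 : F) r) × ↥(ball y r) :=
    e₁.trans (Homeomorph.Set.prod _ _)
  have h0 : (0 : F) ∈ ball (0 : F) r := mem_ball_self hr
  -- the three maps of pairs
  have hPQ : MapsTo h ((Subtype.val ⁻¹' {p : F × K | p.1 = 0})ᶜ : Set ↥(ball ((0 : F), y) r))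
      (({(⟨0, h0⟩ : ↥(ball (0 : F) r))} : Set ↥(ball (0 : F) r)) ×ˢ (univ : Set ↥(ball y r)))ᶜ := by
    intro p hp hq
    exact hp (congrArg Subtype.val hq.1 : (p : F × K).1 = 0)
  have hQP : MapsTo h.symm
      (({(⟨0, h0⟩ : ↥(ball (0 : F) r))} : Set ↥(ball (0 : F) r)) ×ˢ (univ : Set ↥(ball y r)))ᶜ
      ((Subtype.val ⁻¹' {p : F × K | p.1 = 0})ᶜ : Set ↥(ball ((0 : F), y) r)) := by
    intro q hq hp
    refine hq ⟨Subtype.ext ?_, mem_univ _⟩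
    have : ((q.1 : ↥(ball (0 : F) r)) : F) = 0 := hp
    exact this
  haveI i₁ := relativeSingularHomology.isIso_map_homeomorph R R h hPQ hQP n
  haveI : ContractibleSpace ↥(ball y r) :=
    (convex_ball y r).contractibleSpace ⟨y, mem_ball_self hr⟩
  haveI i₂ := localHomologyOfSet.isIso_map_fst_prod R R (B := ↥(ball y r))
    ({(⟨0, h0⟩ : ↥(ball (0 : F) r))}) n
  haveI i₃ := localHomology.isIso_map_subsetIncl_of_isOpen R R (X := F) isOpen_ball h0 n
  have hfac : relativeSingularHomology.map R R
      ((ContinuousMap.fst : C(F × K, F)).comp (subsetIncl (ball ((0 : F), y) r)))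
        (mapsTo_fstVal_ball y r) n =
      relativeSingularHomology.map R R (h : C(_, _)) hPQ n ≫
        relativeSingularHomology.map R R (ContinuousMap.fst : C(↥(ball (0 : F) r) × ↥(ball y r), _))
          (mapsTo_fst_compl_prod {(⟨0, h0⟩ : ↥(ball (0 : F) r))}) n ≫
        relativeSingularHomology.map R R (subsetIncl (ball (0 : F) r))
          (localHomology.mapsTo_subsetIncl_compl h0) n := by
    rw [← relativeSingularHomology.map_comp, ← relativeSingularHomology.map_comp]
    rfl
  rw [hfac]
  infer_instance

omit [NormedSpace ℝ F] [FiniteDimensional ℝ F] in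
/-- **Concentric balls at the flat piece have isomorphic `H_n(· | L)`**: for
`B' = B((0, y'), r') ⊆ B = B((0, y), r)` the inclusion induces an isomorphism `H_n(B' | L) ≅ H_n(B | L)`
(both sides compare to `H_n(F | 0)` through `p ↦ p.1`). [cite: HatcherAT2002, Prop. 2.19 and Thm. 2.20] -/
theorem isIso_map_subsetInclusion_ball {y y' : K} {r r' : ℝ} (hr : 0 < r) (hr' : 0 < r')
    (hsub : ball ((0 : F), y') r' ⊆ ball ((0 : F), y) r) (n : ℕ) :
    IsIso (relativeSingularHomology.map R R (subsetInclusion hsub)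
      (relOpenMV.mapsTo_inclusion_compl hsub {p : F × K | p.1 = 0}) n) := by
  haveI := isIso_map_fstVal_ball R (F := F) y hr n
  haveI := isIso_map_fstVal_ball R (F := F) y' hr' n
  have hfac : relativeSingularHomology.map R R (subsetInclusion hsub)
      (relOpenMV.mapsTo_inclusion_compl hsub {p : F × K | p.1 = 0}) n ≫
      relativeSingularHomology.map R R
        ((ContinuousMap.fst : C(F × K, F)).comp (subsetIncl (ball ((0 : F), y) r)))
        (mapsTo_fstVal_ball y r) n =
      relativeSingularHomology.map R R
        ((ContinuousMap.fst : C(F × K, F)).comp (subsetIncl (ball ((0 : F), y') r')))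
        (mapsTo_fstVal_ball y' r') n := by
    rw [← relativeSingularHomology.map_comp]
    rfl
  haveI : IsIso (relativeSingularHomology.map R R (subsetInclusion hsub)
      (relOpenMV.mapsTo_inclusion_compl hsub {p : F × K | p.1 = 0}) n ≫
      relativeSingularHomology.map R R
        ((ContinuousMap.fst : C(F × K, F)).comp (subsetIncl (ball ((0 : F), y) r)))
        (mapsTo_fstVal_ball y r) n) := by
    rw [hfac]; infer_instance
  exact IsIso.of_isIso_comp_right (relativeSingularHomology.map R R (subsetInclusion hsub)
      (relOpenMV.mapsTo_inclusion_compl hsub {p : F × K | p.1 = 0}) n)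
    (relativeSingularHomology.map R R
      ((ContinuousMap.fst : C(F × K, F)).comp (subsetIncl (ball ((0 : F), y) r)))
      (mapsTo_fstVal_ball y r) n)

/-- Cyclicity passes backwards along an isomorphism of `ModuleCat` objects. [folklore] -/
theorem forall_mem_span_singleton_of_isIso {A B : ModuleCat.{0} R} (f : A ⟶ B) [IsIso f]
    {θ : B} (hθ : ∀ y, y ∈ Submodule.span R ({θ} : Set B)) :
    ∀ x, x ∈ Submodule.span R ({inv f θ} : Set A) := by
  intro x
  have hx : (inv f).hom (f x) ∈ (Submodule.span R ({θ} : Set B)).map (inv f).hom :=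
    Submodule.mem_map_of_mem (hθ (f x))
  rw [Submodule.map_span, Set.image_singleton] at hx
  have h : (inv f).hom (f x) = x := by
    rw [← ModuleCat.comp_apply, IsIso.hom_inv_id, ModuleCat.id_apply]
  rwa [h] at hx

/-- **`H_k(B | L; R)` is generated by one class**, `k = dim F`: by `isIso_map_fstVal_ball` it is
`H_k(F | 0; R) ≅ H_k(ℝᵏ | 0; R) ≅ R` (Hatcher 2002, §3.3 p. 231; `localHomologyIsoOfChart'`).
[cite: HatcherAT2002, §3.3 p. 231] [cite: MilnorStasheff1974, §10] -/
theorem localHomologyOfSet_ball_cyclic (y : K) {r : ℝ} (hr : 0 < r) :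
    ∃ g : localHomologyOfSet R R ↥(ball ((0 : F), y) r)
        (Subtype.val ⁻¹' {p : F × K | p.1 = 0}) (Module.finrank ℝ F),
      ∀ x, x ∈ Submodule.span R ({g} : Set (localHomologyOfSet R R ↥(ball ((0 : F), y) r)
        (Subtype.val ⁻¹' {p : F × K | p.1 = 0}) (Module.finrank ℝ F))) := by
  set k := Module.finrank ℝ F with hk
  -- `H_k(F | 0; R) ≅ R`
  let L : F ≃L[ℝ] RVec k := ContinuousLinearEquiv.ofFinrankEq (by rw [hk]; simp)
  let c : OpenPartialHomeomorph F (RVec k) := L.toHomeomorph.toOpenPartialHomeomorph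
  have hc : (0 : F) ∈ c.source := by simp [c]
  let e := localHomologyIsoOfChart' R R c hc
  -- cyclicity of `ULift R`
  have hU : ∀ y : ModuleCat.of R (ULift.{0} R), y ∈ Submodule.span R ({ULift.up 1} : Set _) := by
    intro y
    refine Submodule.mem_span_singleton.2 ⟨y.down, ?_⟩
    ext
    simp
  -- transport along `H_k(B | L) ≅ H_k(F | 0) ≅ ULift R`
  haveI := isIso_map_fstVal_ball R (F := F) y hr k
  have h1 := forall_mem_span_singleton_of_isIso R e.hom hU
  exact ⟨_, forall_mem_span_singleton_of_isIso R (relativeSingularHomology.map R R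
    ((ContinuousMap.fst : C(F × K, F)).comp (subsetIncl (ball ((0 : F), y) r)))
    (mapsTo_fstVal_ball y r) k) h1⟩

end Model

end Literature.AlgebraicTopology.SingularHomology

end
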